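import Mathlib.Analysis.Analytic.Order
import Mathlib.Probability.Moments.MGFAnalytic
import Literature.MathematicalPhysics.QuantumLattice.WilsonFeynmanHellmann

/-!
# Line `beta-slope-floor` (crux `IR`, stmt-QuantumFields-19354): calculus of the strong-coupling rung

Route `BalabanLadder`, crux `IR`, line `beta-slope-floor` (skeleton `Cruxes/IR/Lines/beta_slope_floor.lean`,
registered stub `stub_rung_strongCoupling`), lead prover `ym-ir-line-bsf-p1`.  Two group-free, lattice-free
tools for the ORDER-OF-VANISHING proof of the strong-coupling rung:

* §1 `exists_slope_floor_of_le_analyticOrderAt` — if `f` is real-analytic at `0`, non-negative on a right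
  neighbourhood of `0`, and vanishes at `0` to order at least `N` (`(N : ℕ∞) ≤ analyticOrderAt f 0`), then for
  some `K` and `β₀ > 0` the slope floor `(N / b − K) · f b ≤ f' b` holds for all `0 < b ≤ β₀`.  (Write
  `f = b^m g`, `m ≥ N`, `g 0 > 0`; then `f' = m b^{m-1} g + b^m g'` and `K = 2 sup|g'| / g 0`.)
* §2 `analyticAt_integral_mul_exp`, `iteratedDeriv_integral_mul_exp` — for a finite measure `μ` and bounded
  measurable `Φ, T`, the tilted moment `b ↦ ∫ Φ · e^{bT} dμ` is real-analytic on `ℝ` with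
  `j`-th derivative `∫ Φ · T^j · e^{bT} dμ` (reduction to Mathlib's `analyticAt_mgf` / `iteratedDeriv_mgf`
  for the two finite measures `(Φ + C) · μ` and `μ`); hence `le_analyticOrderAt_integral_mul_exp`: if the
  plain moments `∫ Φ · T^j dμ` vanish for `j < N`, the tilted moment vanishes at `0` to order `≥ N`.

Honest framing: pure calculus; nothing here bears on the Yang–Mills mass gap (Clay).  R4 of the ladder closes
only the conditional finite-𝕋⁴ rung `BalabanLadder.UV`.
Refs: B. Simon, *The Statistical Mechanics of Lattice Gases* I (1993) §II.1; line card
`Cruxes/IR/Lines/beta-slope-floor.md`.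
-/

set_option autoImplicit false

noncomputable section

open MeasureTheory ProbabilityTheory Filter Topology Real

namespace Summit.QuantumFields.YangMills.Cruxes.IR.BetaSlopeFloor

/-! ## §1 A slope floor from the order of vanishing -/

/-- If `f = b^m · g` near `0` with `g` analytic, then `f' b = m b^{m-1} g b + b^m g' b` near `0`. -/
private theorem deriv_eq_of_eventuallyEq_pow_mul {f g : ℝ → ℝ} {m : ℕ}
    (hfg : ∀ᶠ z in 𝓝 (0 : ℝ), f z = z ^ m * g z) (hg : ∀ᶠ z in 𝓝 (0 : ℝ), AnalyticAt ℝ g z) :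
    ∀ᶠ b in 𝓝 (0 : ℝ), deriv f b = m * b ^ (m - 1) * g b + b ^ m * deriv g b := by
  filter_upwards [eventually_eventually_nhds.2 hfg, hg] with b hb hgb
  have h1 : deriv f b = deriv (fun z => z ^ m * g z) b := Filter.EventuallyEq.deriv_eq hb
  rw [h1, deriv_fun_mul (differentiableAt_pow m) hgb.differentiableAt, deriv_pow_field]

/-- **Slope floor from the order of vanishing.**  Let `f : ℝ → ℝ` be analytic at `0`, non-negative on
`(0, ε)` for some `ε > 0`, and vanish at `0` to order at least `N`.  Then there are `K` and `β₀ > 0` with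
`(N / b − K) · f b ≤ deriv f b` for all `0 < b ≤ β₀`. -/
theorem exists_slope_floor_of_le_analyticOrderAt {f : ℝ → ℝ} (hf : AnalyticAt ℝ f 0) {ε : ℝ}
    (hε : 0 < ε) (hpos : ∀ b, 0 < b → b < ε → 0 ≤ f b) {N : ℕ}
    (hN : (N : ℕ∞) ≤ analyticOrderAt f 0) :
    ∃ K β₀ : ℝ, 0 < β₀ ∧ ∀ b : ℝ, 0 < b → b ≤ β₀ → (N / b - K) * f b ≤ deriv f b := by
  rcases eq_or_ne (analyticOrderAt f 0) ⊤ with htop | hfin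
  · -- `f` vanishes identically near `0`, hence so does its derivative
    have h0 : ∀ᶠ z in 𝓝 (0 : ℝ), f z = 0 := analyticOrderAt_eq_top.1 htop
    have hd : ∀ᶠ b in 𝓝 (0 : ℝ), deriv f b = 0 := by
      filter_upwards [eventually_eventually_nhds.2 h0] with b hb
      rw [Filter.EventuallyEq.deriv_eq (hb : f =ᶠ[𝓝 b] fun _ => (0 : ℝ)), deriv_const]
    obtain ⟨δ, hδ, hball⟩ := Metric.eventually_nhds_iff.1 (h0.and hd)
    refine ⟨0, δ / 2, by positivity, fun b hb hbδ => ?_⟩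
    have hb' : dist b 0 < δ := by
      rw [Real.dist_eq, sub_zero, abs_of_pos hb]; linarith
    obtain ⟨h1, h2⟩ := hball hb'
    rw [h1, h2, mul_zero]
  · -- `f = b^m g`, `g 0 ≠ 0`, `m ≥ N`
    obtain ⟨m, hm⟩ := ENat.ne_top_iff_exists.1 hfin
    obtain ⟨g, hg, hg0, hfg⟩ := (hf.analyticOrderAt_eq_natCast).1 hm.symm
    have hNm : N ≤ m := by
      have : (N : ℕ∞) ≤ (m : ℕ∞) := hm ▸ hN
      exact_mod_cast this
    simp only [sub_zero, smul_eq_mul] at hfg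
    -- `g 0 > 0` from non-negativity of `f` on `(0, ε)`
    obtain ⟨δ₁, hδ₁, hball₁⟩ := Metric.eventually_nhds_iff.1 hfg
    have hgpos : 0 < g 0 := by
      rcases lt_or_gt_of_ne hg0 with hlt | hgt
      · exfalso
        -- `g < 0` near `0`, contradicting `f ≥ 0` on small positive `b`
        have hneg : ∀ᶠ z in 𝓝 (0 : ℝ), g z < 0 := hg.continuousAt.eventually (gt_mem_nhds hlt)
        obtain ⟨δ₂, hδ₂, hball₂⟩ := Metric.eventually_nhds_iff.1 hneg
        set b : ℝ := min (min δ₁ δ₂) ε / 2 with hb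
        have hbpos : 0 < b := by rw [hb]; positivity
        have hb1 : dist b 0 < δ₁ := by
          rw [Real.dist_eq, sub_zero, abs_of_pos hbpos, hb]
          linarith [min_le_left (min δ₁ δ₂) ε, min_le_left δ₁ δ₂]
        have hb2 : dist b 0 < δ₂ := by
          rw [Real.dist_eq, sub_zero, abs_of_pos hbpos, hb]
          linarith [min_le_left (min δ₁ δ₂) ε, min_le_right δ₁ δ₂]
        have hbε : b < ε := by
          rw [hb]; linarith [min_le_right (min δ₁ δ₂) ε]
        have h1 : f b = b ^ m * g b := hball₁ hb1
        have h2 : g b < 0 := hball₂ hb2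
        have h3 : 0 ≤ f b := hpos b hbpos hbε
        have h4 : b ^ m * g b < 0 := mul_neg_of_pos_of_neg (pow_pos hbpos m) h2
        linarith
      · exact hgt
    -- bounds for `g` and `g'` near `0`
    have hg_near : ∀ᶠ z in 𝓝 (0 : ℝ), AnalyticAt ℝ g z := hg.eventually_analyticAt
    have hglow : ∀ᶠ z in 𝓝 (0 : ℝ), g 0 / 2 < g z :=
      hg.continuousAt.eventually (lt_mem_nhds (by linarith))
    have hg'bd : ∀ᶠ z in 𝓝 (0 : ℝ), |deriv g z| < |deriv g 0| + 1 := by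
      have hc : ContinuousAt (fun z => |deriv g z|) 0 := hg.deriv.continuousAt.abs
      exact hc.eventually (gt_mem_nhds (by linarith))
    have hderiv := deriv_eq_of_eventuallyEq_pow_mul hfg hg_near
    obtain ⟨δ, hδ, hball⟩ :=
      Metric.eventually_nhds_iff.1 ((hfg.and hglow).and (hg'bd.and hderiv))
    set M : ℝ := |deriv g 0| + 1 with hM
    refine ⟨2 * M / g 0, δ / 2, by positivity, fun b hb hbδ => ?_⟩
    have hb' : dist b 0 < δ := by
      rw [Real.dist_eq, sub_zero, abs_of_pos hb]; linarith
    obtain ⟨⟨h1, h2⟩, h3, h4⟩ := hball hb'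
    rw [h1, h4]
    have hbne : b ≠ 0 := hb.ne'
    have hgb : 0 < g b := by linarith
    have hpow : 0 < b ^ m := pow_pos hb m
    have hpow1 : 0 ≤ b ^ (m - 1) := (pow_pos hb _).le
    -- `N / b * b^m = N * b^(m-1) ≤ m * b^(m-1)` (needs `m ≥ 1` or `N = 0`)
    have hA : (N : ℝ) / b * (b ^ m * g b) ≤ m * b ^ (m - 1) * g b := by
      rcases Nat.eq_zero_or_pos m with hm0 | hmpos
      · have hN0 : N = 0 := Nat.le_zero.1 (hm0 ▸ hNm)
        simp [hN0, hm0]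
      · have hbm : b ^ m = b * b ^ (m - 1) := by
          rw [← pow_succ']; congr 1; omega
        rw [hbm]
        have : (N : ℝ) / b * (b * b ^ (m - 1) * g b) = N * (b ^ (m - 1) * g b) := by
          field_simp
        rw [this]
        have hNm' : (N : ℝ) ≤ m := by exact_mod_cast hNm
        nlinarith [mul_nonneg hpow1 hgb.le]
    -- `K * b^m * g b ≥ b^m * |g'|`
    have hB : -(2 * M / g 0) * (b ^ m * g b) ≤ b ^ m * deriv g b := by
      have hg'le : |deriv g b| < M := h3
      have hd : -M ≤ deriv g b := by linarith [neg_abs_le (deriv g b)]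
      have hK : M ≤ 2 * M / g 0 * g b := by
        rw [div_mul_eq_mul_div, le_div_iff₀ hgpos]
        have hM0 : 0 ≤ M := by positivity
        nlinarith
      nlinarith
    nlinarith

/-! ## §2 Tilted moments of bounded variables are entire -/

section Tilted

variable {Ω : Type*} [MeasurableSpace Ω] (μ : Measure Ω) [IsFiniteMeasure μ]
  {Φ T : Ω → ℝ} {C B : ℝ}

/-- The reweighted measure `(Φ + C) · μ` (used to reduce signed tilted moments to moment generating
functions) is finite. -/
private theorem isFiniteMeasure_shiftedMeasure (hΦ : ∀ ω, |Φ ω| ≤ C) :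
    IsFiniteMeasure (μ.withDensity fun ω => ((Φ ω + C).toNNReal : ENNReal)) := by
  refine isFiniteMeasure_withDensity ?_
  have hbd : ∀ ω, ((Φ ω + C).toNNReal : ENNReal) ≤ ENNReal.ofReal (2 * C) := fun ω => by
    rw [ENNReal.ofReal]
    exact ENNReal.coe_le_coe.2 (Real.toNNReal_le_toNNReal (by linarith [le_abs_self (Φ ω), hΦ ω]))
  refine ne_of_lt (lt_of_le_of_lt (lintegral_mono hbd) ?_)
  rw [lintegral_const]
  exact ENNReal.mul_lt_top ENNReal.ofReal_lt_top (measure_lt_top _ _)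

omit [IsFiniteMeasure μ] in
/-- Integration against `(Φ + C) · μ`. -/
private theorem integral_shiftedMeasure (hΦm : Measurable Φ) (hΦ : ∀ ω, |Φ ω| ≤ C) (g : Ω → ℝ) :
    ∫ ω, g ω ∂(μ.withDensity fun ω => ((Φ ω + C).toNNReal : ENNReal)) = ∫ ω, (Φ ω + C) * g ω ∂μ := by
  rw [integral_withDensity_eq_integral_smul (by fun_prop)]
  refine integral_congr_ae (ae_of_all _ fun ω => ?_)
  have h0 : 0 ≤ Φ ω + C := by linarith [neg_abs_le (Φ ω), hΦ ω]
  simp [NNReal.smul_def, Real.coe_toNNReal _ h0]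

/-- The tilted moment `b ↦ ∫ Φ e^{bT} dμ` as a difference of two moment generating functions. -/
private theorem integral_mul_exp_eq_mgf_sub (hΦm : Measurable Φ) (hΦ : ∀ ω, |Φ ω| ≤ C)
    (hTm : Measurable T) (hT : ∀ ω, |T ω| ≤ B) (b : ℝ) :
    ∫ ω, Φ ω * Real.exp (b * T ω) ∂μ =
      mgf T (μ.withDensity fun ω => ((Φ ω + C).toNNReal : ENNReal)) b - C * mgf T μ b := by
  simp only [mgf]
  rw [integral_shiftedMeasure μ hΦm hΦ, ← integral_const_mul, ← integral_sub]
  · refine integral_congr_ae (ae_of_all _ fun ω => ?_)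
    simp only
    ring
  · refine Integrable.of_bound (C := 2 * C * Real.exp (|b| * B)) (by fun_prop) (ae_of_all _ fun ω => ?_)
    rw [Real.norm_eq_abs, abs_mul]
    have h1 : |Φ ω + C| ≤ 2 * C := by
      rw [abs_le]; constructor <;> linarith [neg_abs_le (Φ ω), le_abs_self (Φ ω), hΦ ω]
    have h2 : |Real.exp (b * T ω)| ≤ Real.exp (|b| * B) := by
      rw [Real.abs_exp, Real.exp_le_exp]
      calc b * T ω ≤ |b * T ω| := le_abs_self _
        _ = |b| * |T ω| := abs_mul _ _
        _ ≤ |b| * B := by gcongr; exact hT ω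
    exact mul_le_mul h1 h2 (abs_nonneg _) (by linarith [abs_nonneg (Φ ω), hΦ ω])
  · refine Integrable.of_bound (C := |C| * Real.exp (|b| * B)) (by fun_prop) (ae_of_all _ fun ω => ?_)
    rw [Real.norm_eq_abs, abs_mul]
    gcongr
    rw [Real.abs_exp, Real.exp_le_exp]
    calc b * T ω ≤ |b * T ω| := le_abs_self _
      _ = |b| * |T ω| := abs_mul _ _
      _ ≤ |b| * B := by gcongr; exact hT ω

/-- Bounded variables have all exponential moments under a finite measure. -/
private theorem mem_interior_integrableExpSet (hTm : Measurable T) (hT : ∀ ω, |T ω| ≤ B)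
    (ν : Measure Ω) [IsFiniteMeasure ν] (b : ℝ) : b ∈ interior (integrableExpSet T ν) := by
  rw [Literature.MathematicalPhysics.QuantumLattice.integrableExpSet_eq_univ_of_abs_le
    hTm.aemeasurable (ae_of_all _ hT), interior_univ]
  trivial

/-- **Tilted moments of bounded variables are entire.**  For a finite measure `μ` and bounded measurable
`Φ, T : Ω → ℝ`, the map `b ↦ ∫ Φ · e^{bT} dμ` is real-analytic at every `b`. -/
theorem analyticAt_integral_mul_exp (hΦm : Measurable Φ) (hΦ : ∀ ω, |Φ ω| ≤ C)
    (hTm : Measurable T) (hT : ∀ ω, |T ω| ≤ B) (b : ℝ) :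
    AnalyticAt ℝ (fun b' => ∫ ω, Φ ω * Real.exp (b' * T ω) ∂μ) b := by
  haveI := isFiniteMeasure_shiftedMeasure μ hΦ
  have heq : (fun b' => ∫ ω, Φ ω * Real.exp (b' * T ω) ∂μ) =
      fun b' => mgf T (μ.withDensity fun ω => ((Φ ω + C).toNNReal : ENNReal)) b' - C * mgf T μ b' :=
    funext (integral_mul_exp_eq_mgf_sub μ hΦm hΦ hTm hT)
  rw [heq]
  exact (analyticAt_mgf (mem_interior_integrableExpSet hTm hT _ b)).sub
    (analyticAt_const.mul (analyticAt_mgf (mem_interior_integrableExpSet hTm hT _ b)))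

/-- **Derivatives of tilted moments are tilted higher moments**:
`(d/db)^j ∫ Φ e^{bT} dμ = ∫ Φ · T^j · e^{bT} dμ`. -/
theorem iteratedDeriv_integral_mul_exp (hΦm : Measurable Φ) (hΦ : ∀ ω, |Φ ω| ≤ C)
    (hTm : Measurable T) (hT : ∀ ω, |T ω| ≤ B) (j : ℕ) (b : ℝ) :
    iteratedDeriv j (fun b' => ∫ ω, Φ ω * Real.exp (b' * T ω) ∂μ) b =
      ∫ ω, Φ ω * (T ω ^ j * Real.exp (b * T ω)) ∂μ := by
  haveI := isFiniteMeasure_shiftedMeasure μ hΦ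
  have heq : (fun b' => ∫ ω, Φ ω * Real.exp (b' * T ω) ∂μ) =
      fun b' => mgf T (μ.withDensity fun ω => ((Φ ω + C).toNNReal : ENNReal)) b' - C * mgf T μ b' :=
    funext (integral_mul_exp_eq_mgf_sub μ hΦm hΦ hTm hT)
  have hb1 := mem_interior_integrableExpSet hTm hT (μ.withDensity fun ω => ((Φ ω + C).toNNReal : ENNReal)) b
  have hb2 := mem_interior_integrableExpSet hTm hT μ b
  have hcd1 : ContDiffAt ℝ j (mgf T (μ.withDensity fun ω => ((Φ ω + C).toNNReal : ENNReal))) b := (analyticAt_mgf hb1).contDiffAt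
  have hcd2 : ContDiffAt ℝ j (fun b' => C * mgf T μ b') b :=
    (analyticAt_const.mul (analyticAt_mgf hb2)).contDiffAt
  rw [heq]
  rw [show (fun b' => mgf T (μ.withDensity fun ω => ((Φ ω + C).toNNReal : ENNReal)) b' - C * mgf T μ b') =
      (mgf T (μ.withDensity fun ω => ((Φ ω + C).toNNReal : ENNReal))) - (fun b' => C * mgf T μ b') from rfl]
  rw [iteratedDeriv_sub hcd1 hcd2, iteratedDeriv_const_mul C (analyticAt_mgf hb2).contDiffAt,
    iteratedDeriv_mgf hb1, iteratedDeriv_mgf hb2, integral_shiftedMeasure μ hΦm hΦ,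
    ← integral_const_mul, ← integral_sub]
  · refine integral_congr_ae (ae_of_all _ fun ω => ?_)
    simp only
    ring
  · refine Integrable.of_bound (C := 2 * C * (B ^ j * Real.exp (|b| * B))) (by fun_prop)
      (ae_of_all _ fun ω => ?_)
    rw [Real.norm_eq_abs, abs_mul, abs_mul]
    have h1 : |Φ ω + C| ≤ 2 * C := by
      rw [abs_le]; constructor <;> linarith [neg_abs_le (Φ ω), le_abs_self (Φ ω), hΦ ω]
    have h2 : |Real.exp (b * T ω)| ≤ Real.exp (|b| * B) := by
      rw [Real.abs_exp, Real.exp_le_exp]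
      calc b * T ω ≤ |b * T ω| := le_abs_self _
        _ = |b| * |T ω| := abs_mul _ _
        _ ≤ |b| * B := by gcongr; exact hT ω
    have h3 : |T ω ^ j| ≤ B ^ j := by rw [abs_pow]; exact pow_le_pow_left₀ (abs_nonneg _) (hT ω) j
    have hC0 : 0 ≤ C := le_trans (abs_nonneg _) (hΦ ω)
    exact mul_le_mul h1 (mul_le_mul h3 h2 (abs_nonneg _) (pow_nonneg (le_trans (abs_nonneg _) (hT ω)) j))
      (mul_nonneg (abs_nonneg _) (abs_nonneg _)) (by linarith)
  · refine Integrable.of_bound (C := |C| * (B ^ j * Real.exp (|b| * B))) (by fun_prop)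
      (ae_of_all _ fun ω => ?_)
    rw [Real.norm_eq_abs, abs_mul, abs_mul]
    have h2 : |Real.exp (b * T ω)| ≤ Real.exp (|b| * B) := by
      rw [Real.abs_exp, Real.exp_le_exp]
      calc b * T ω ≤ |b * T ω| := le_abs_self _
        _ = |b| * |T ω| := abs_mul _ _
        _ ≤ |b| * B := by gcongr; exact hT ω
    have h3 : |T ω ^ j| ≤ B ^ j := by rw [abs_pow]; exact pow_le_pow_left₀ (abs_nonneg _) (hT ω) j
    exact mul_le_mul_of_nonneg_left
      (mul_le_mul h3 h2 (abs_nonneg _) (pow_nonneg (le_trans (abs_nonneg _) (hT ω)) j))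
      (abs_nonneg _)

/-- **Vanishing plain moments force vanishing order of the tilted moment at `0`.**  If
`∫ Φ · T^j dμ = 0` for all `j < N`, then `b ↦ ∫ Φ e^{bT} dμ` vanishes at `b = 0` to order `≥ N`. -/
theorem le_analyticOrderAt_integral_mul_exp (hΦm : Measurable Φ) (hΦ : ∀ ω, |Φ ω| ≤ C)
    (hTm : Measurable T) (hT : ∀ ω, |T ω| ≤ B) {N : ℕ}
    (hmom : ∀ j < N, ∫ ω, Φ ω * T ω ^ j ∂μ = 0) :
    (N : ℕ∞) ≤ analyticOrderAt (fun b' => ∫ ω, Φ ω * Real.exp (b' * T ω) ∂μ) 0 := by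
  rw [natCast_le_analyticOrderAt_iff_iteratedDeriv_eq_zero
    (analyticAt_integral_mul_exp μ hΦm hΦ hTm hT 0)]
  intro j hj
  rw [iteratedDeriv_integral_mul_exp μ hΦm hΦ hTm hT j 0]
  simpa using hmom j hj

end Tilted

end Summit.QuantumFields.YangMills.Cruxes.IR.BetaSlopeFloor

end
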